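import Summits.QuantumFields.YangMills.Theorems.AllWindowsColdBoxBoxHighLineWilsonPlaquetteTaylorCore

/-!
# T-S5.7a `wilsonPlaquetteTaylor : WilsonPlaquetteTaylor` BY NAME — the Wilson plaquette cost in the edge chart to fourth order, with the
# cubic (odd) term a triple product (STUB-PLAN-S5-STEP2 §3/§8, task file ✓`…Theorems.AllWindowsColdBoxBoxHighLineStep2Wick`; LINE-19 S5 ⟨stmt-QuantumFields-24004⟩/⟨24335⟩)

Width seat `ym-line-sfw-p2-w2` (g31, cell `ym-idea-1`), routed by planner ym-idea-2 g18 («7a → w2 successor after 6a», 2026-08-29T19:32:11Z).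

**Theorem (`wilsonPlaquetteTaylor`, `C = 42`).**  For every plane `μ ≠ ν` the tensor `T` with `T(1,2,3) = T(0,2,3) = −2`, `T(0,1,3) = T(0,1,2) = 2`
(zero otherwise) satisfies: whenever the four edge variables `v = plaqVar H x μ ν a` have norms `≤ t ≤ 1`,
`|c_p − ‖v₀+v₁−v₂−v₃‖² − c_p^{odd}| ≤ 42·t⁴` and `|c_p^{odd} − Σ T_{ijk} v_i·(v_j × v_k)| ≤ 42·t⁵` — from the generic four-point estimates of
✓`…WilsonPlaquetteTaylorCore` (`WilsonTaylor.abs_even_remainder_le`, `abs_odd_remainder_le`), the chart identity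
✓`WilsonSandwich.chartPlaqCost_eq` and oddness of the chart (`WilsonTaylor.plaqVar_neg`).

Everything proved, Mathlib + tree only, standard axioms; no definitions.
HONEST LABEL: an M-sized brick of STEP 2 of the XL stub S5 (`stub_landauSecondOrder`) of a critic-PASSed DRAFT line; S5, U5, ⟨24004⟩ ⟨24335⟩ ⟨24336⟩
remain OPEN; no stub is closed by name, no crux, rung or summit is proved; **the Yang–Mills mass gap is NOT proved by this file.**
-/

set_option autoImplicit false

noncomputable section

open Matrix Finset
open Literature.Probability.LatticeModels (Site)
open Literature.MathematicalPhysics.QuantumFieldTheory.Balaban1983to89.B10Eq18SigmaSU2Haar (expPauli)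

namespace Summit.QuantumFields.YangMills.Theorems.AllWindowsColdBoxBoxHighLine

/-! ## T-S5.7a by name -/

open WilsonTaylor in
/-- **T-S5.7a `WilsonPlaquetteTaylor`, BY NAME** (`C = 42`; `T(1,2,3) = T(0,2,3) = −2`, `T(0,1,3) = T(0,1,2) = 2`, zero otherwise). -/
theorem wilsonPlaquetteTaylor : WilsonPlaquetteTaylor := by
  refine ⟨42, fun μ ν _ => ⟨fun i j k =>
    if i = 1 ∧ j = 2 ∧ k = 3 then -2 else if i = 0 ∧ j = 2 ∧ k = 3 then -2 else if i = 0 ∧ j = 1 ∧ k = 3 then 2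
      else if i = 0 ∧ j = 1 ∧ k = 2 then 2 else 0, fun i j k => by dsimp only; split_ifs <;> norm_num,
    fun H x t a ht0 ht1 hv => ?_⟩⟩
  have hodd : chartPlaqCostOdd H x μ ν a =
      ((2 - (((expPauli (plaqVar H x μ ν a 0) * expPauli (plaqVar H x μ ν a 1) * (expPauli (plaqVar H x μ ν a 2))⁻¹ *
          (expPauli (plaqVar H x μ ν a 3))⁻¹ : SU2) : Matrix (Fin 2) (Fin 2) ℂ)).trace.re)
        - (2 - (((expPauli (-plaqVar H x μ ν a 0) * expPauli (-plaqVar H x μ ν a 1) * (expPauli (-plaqVar H x μ ν a 2))⁻¹ *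
          (expPauli (-plaqVar H x μ ν a 3))⁻¹ : SU2) : Matrix (Fin 2) (Fin 2) ℂ)).trace.re)) / 2 := by
    rw [chartPlaqCostOdd, WilsonSandwich.chartPlaqCost_eq, WilsonSandwich.chartPlaqCost_eq]
    simp only [plaqVar_neg]
  have htriple : tripleForm (fun i j k : Fin 4 =>
      if i = 1 ∧ j = 2 ∧ k = 3 then (-2 : ℝ) else if i = 0 ∧ j = 2 ∧ k = 3 then -2 else if i = 0 ∧ j = 1 ∧ k = 3 then 2
        else if i = 0 ∧ j = 1 ∧ k = 2 then 2 else 0) (plaqVar H x μ ν a) =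
      -2 * (WithLp.ofLp (plaqVar H x μ ν a 1) ⬝ᵥ (WithLp.ofLp (plaqVar H x μ ν a 2) ⨯₃ WithLp.ofLp (plaqVar H x μ ν a 3)))
        - 2 * (WithLp.ofLp (plaqVar H x μ ν a 0) ⬝ᵥ (WithLp.ofLp (plaqVar H x μ ν a 2) ⨯₃ WithLp.ofLp (plaqVar H x μ ν a 3)))
        + 2 * (WithLp.ofLp (plaqVar H x μ ν a 0) ⬝ᵥ (WithLp.ofLp (plaqVar H x μ ν a 1) ⨯₃ WithLp.ofLp (plaqVar H x μ ν a 3)))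
        + 2 * (WithLp.ofLp (plaqVar H x μ ν a 0) ⬝ᵥ (WithLp.ofLp (plaqVar H x μ ν a 1) ⨯₃ WithLp.ofLp (plaqVar H x μ ν a 2))) := by
    simp only [tripleForm, Fin.sum_univ_four, Fin.isValue, Fin.reduceEq, and_true, and_false, if_true, if_false, zero_mul, add_zero,
      zero_add]
    ring
  refine ⟨?_, ?_⟩
  · rw [hodd, WilsonSandwich.chartPlaqCost_eq]
    exact abs_even_remainder_le (plaqVar H x μ ν a) ht0 ht1 hv
  · rw [hodd, htriple]
    exact (abs_odd_remainder_le (plaqVar H x μ ν a) ht1 hv).trans (by nlinarith [pow_nonneg ht0 5])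

end Summit.QuantumFields.YangMills.Theorems.AllWindowsColdBoxBoxHighLine

end
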